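import Mathlib.RingTheory.RootsOfUnity.Lemmas
import Mathlib.RingTheory.RootsOfUnity.CyclotomicUnits
import Mathlib.RingTheory.RootsOfUnity.Minpoly
import Literature.NumberTheory.GaloisRepresentations.ModNCyclotomicCharacter
import HarnessLib

/-! # The cyclotomic uniformiser above a prime `N` — stub `stub_cycChar` of line `Sketch`,
# crux `MazurKenkuBound` (stmt-ABC-15125)

WHAT. For a primitive `N`-th root of unity `ζ ∈ ℚ̄` (`N` prime):
* `(ζ - 1) ^ (N - 1) = N · ε` with `ε` and `ε⁻¹` integral over `ℤ` (so `π₀ = ζ - 1` is a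
  uniformiser above `N` with `π₀ ^ (N - 1)` a unit multiple of `N` in `\bar ℤ`);
* for every `σ ∈ Γ_ℚ`, `σ (ζ - 1) = (ζ - 1) (c + (ζ - 1) m)` with `m ∈ \bar ℤ` and
  `c = χ̄_N(σ)` (the value, in `ℕ`, of the mod `N` cyclotomic character), i.e.
  `σ(π₀) / π₀ ≡ χ̄_N(σ) (mod π₀)` — the algebraic form of "`χ̄_N = θ_{N-1}` on inertia".

SOURCE. Folklore (Washington, *Cyclotomic Fields*, Lemma 1.4 and Prop. 2.8; used in Mazur 1978,
proof of Prop. 5.1).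

PROOF. Part 1 is computed inside the domain `R = \bar ℤ = integralClosure ℤ ℚ̄`, where `ζ` is
still a primitive `N`-th root of unity: Mathlib's `IsPrimitiveRoot.prod_pow_sub_one_eq_order`
(`(-1)^{N-1} ∏_{0<k<N} (ζ^k - 1) = N`) and `IsPrimitiveRoot.associated_sub_one_pow_sub_one_of_coprime`
(`ζ - 1 ~ ζ^k - 1` for `k` coprime to `N`) show that `(ζ - 1)^{N-1}` and `N` are associated in
`R`; the unit is `ε⁻¹`. Part 2: `σ ζ = ζ ^ c` (`modNCyclotomicCharacter_spec`), so
`σ (ζ - 1) = ζ ^ c - 1 = (ζ - 1) ∑_{i<c} ζ^i` and `∑_{i<c} ζ^i = c + (ζ - 1) ∑_{i<c} ∑_{j<i} ζ^j`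
(geometric sums), with `m = ∑_{i<c} ∑_{j<i} ζ^j` integral. -/

-- `Summit.<Summit>.<Problem>` is the mandated summit-side namespace (CONVENTIONS §2); for the
-- single-conjunct summit `ABC` the two coincide, so the duplicate `ABC.ABC` is deliberate.
set_option linter.dupNamespace false

noncomputable section

open Field Literature.NumberTheory.GaloisRepresentations
open Finset

namespace Summit.ABC.ABC.Theorems

/-- In a domain containing a primitive `(n+1)`-th root of unity `μ` with `n + 1` prime,
`(μ - 1) ^ n` is associated with `n + 1`: each `μ ^ k - 1` (`0 < k ≤ n`) is associated with
`μ - 1`, and `(-1)^n ∏_{0<k≤n} (μ ^ k - 1) = n + 1`. [folklore] -/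
private theorem sub_one_pow_associated_natCast_of_prime {R : Type*} [CommRing R] [IsDomain R]
    {n : ℕ} (hp : (n + 1).Prime) {μ : R} (hμ : IsPrimitiveRoot μ (n + 1)) :
    Associated ((μ - 1) ^ n) ((n + 1 : ℕ) : R) := by
  have h1 : Associated ((μ - 1) ^ n) (∏ k ∈ range n, (μ ^ (k + 1) - 1)) := by
    have hc : (μ - 1) ^ n = ∏ _k ∈ range n, (μ - 1) := by
      rw [Finset.prod_const, Finset.card_range]
    rw [hc]
    refine Associated.prod _ _ _ fun k hk => hμ.associated_sub_one_pow_sub_one_of_coprime ?_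
    rw [Finset.mem_range] at hk
    exact (Nat.coprime_of_lt_prime k.succ_ne_zero (by omega) hp).symm
  have h2 : Associated (∏ k ∈ range n, (μ ^ (k + 1) - 1)) ((n + 1 : ℕ) : R) := by
    refine ⟨(-1) ^ n, ?_⟩
    rw [Units.val_pow_eq_pow_val, Units.val_neg, Units.val_one, mul_comm,
      hμ.prod_pow_sub_one_eq_order]
    push_cast
    rfl
  exact h1.trans h2

/-- **The cyclotomic uniformiser**: for a primitive `N`-th root of unity `ζ ∈ ℚ̄`
(`N` prime), `(ζ - 1)^{N-1} = N · ε` with `ε` a unit of `\bar ℤ`, and for every `σ ∈ Γ_ℚ`,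
`σ(ζ - 1) = (ζ - 1)(c + (ζ - 1) m)` with `m ∈ \bar ℤ` and `c = χ̄_N(σ)` (`σζ = ζᶜ`,
`(ζᶜ - 1)/(ζ - 1) = 1 + ζ + ⋯ + ζ^{c-1} ≡ c`). [folklore] -/
theorem stub_cycChar (N : ℕ) [Fact N.Prime] {ζ : AlgebraicClosure ℚ} (hζ : IsPrimitiveRoot ζ N) :
    (∃ ε : AlgebraicClosure ℚ, IsIntegral ℤ ε ∧ IsIntegral ℤ ε⁻¹ ∧
        (ζ - 1) ^ (N - 1) = (N : AlgebraicClosure ℚ) * ε) ∧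
      ∀ σ : absoluteGaloisGroup ℚ, ∃ m : AlgebraicClosure ℚ, IsIntegral ℤ m ∧
        σ • (ζ - 1) = (ζ - 1) *
          ((((modNCyclotomicCharacter ℚ N σ : (ZMod N)ˣ) : ZMod N).val : AlgebraicClosure ℚ) +
            (ζ - 1) * m) := by
  have hp : N.Prime := Fact.out
  have hζint : IsIntegral ℤ ζ := hζ.isIntegral hp.pos
  refine ⟨?_, fun σ => ?_⟩
  · -- Part 1: work in the domain `R = integralClosure ℤ ℚ̄`.
    set R : Subalgebra ℤ (AlgebraicClosure ℚ) := integralClosure ℤ (AlgebraicClosure ℚ)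
    set μ : R := ⟨ζ, hζint⟩ with hμdef
    have hμ : IsPrimitiveRoot μ N :=
      (IsPrimitiveRoot.coe_submonoidClass_iff (M := AlgebraicClosure ℚ) (ζ := μ)).1 hζ
    have hN1 : N - 1 + 1 = N := Nat.sub_add_cancel hp.one_lt.le
    have hassoc : Associated ((μ - 1) ^ (N - 1)) ((N : ℕ) : R) := by
      have h := sub_one_pow_associated_natCast_of_prime (n := N - 1) (by rwa [hN1]) (μ := μ)
        (by rwa [hN1])
      rwa [hN1] at h
    obtain ⟨u, hu⟩ := hassoc
    have hU : (ζ - 1) ^ (N - 1) * ((u : R) : AlgebraicClosure ℚ) = N := by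
      have h := congrArg Subtype.val hu
      simpa [hμdef] using h
    have hUε : ((u : R) : AlgebraicClosure ℚ) * (((u⁻¹ : Rˣ) : R) : AlgebraicClosure ℚ) = 1 := by
      rw [← Subalgebra.coe_mul, Units.mul_inv, Subalgebra.coe_one]
    refine ⟨(((u⁻¹ : Rˣ) : R) : AlgebraicClosure ℚ), ((u⁻¹ : Rˣ) : R).2, ?_, ?_⟩
    · rw [inv_eq_of_mul_eq_one_left hUε]
      exact (u : R).2
    · calc (ζ - 1) ^ (N - 1)
          = (ζ - 1) ^ (N - 1) * (((u : R) : AlgebraicClosure ℚ) *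
              (((u⁻¹ : Rˣ) : R) : AlgebraicClosure ℚ)) := by rw [hUε, mul_one]
        _ = (ζ - 1) ^ (N - 1) * ((u : R) : AlgebraicClosure ℚ) *
              (((u⁻¹ : Rˣ) : R) : AlgebraicClosure ℚ) := by rw [mul_assoc]
        _ = (N : AlgebraicClosure ℚ) * (((u⁻¹ : Rˣ) : R) : AlgebraicClosure ℚ) := by rw [hU]
  · -- Part 2: `σ ζ = ζ ^ c`, geometric sums.
    set c : ℕ := ((modNCyclotomicCharacter ℚ N σ : (ZMod N)ˣ) : ZMod N).val
    have hσζ : σ • ζ = ζ ^ c := modNCyclotomicCharacter_spec ℚ N σ ζ hζ.pow_eq_one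
    refine ⟨∑ i ∈ range c, ∑ j ∈ range i, ζ ^ j, ?_, ?_⟩
    · exact IsIntegral.sum _ fun i _ => IsIntegral.sum _ fun j _ => hζint.pow j
    · have key : ∑ i ∈ range c, ζ ^ i =
          (c : AlgebraicClosure ℚ) + (ζ - 1) * ∑ i ∈ range c, ∑ j ∈ range i, ζ ^ j := by
        rw [Finset.mul_sum]
        simp_rw [mul_geom_sum]
        rw [Finset.sum_sub_distrib, Finset.sum_const, Finset.card_range, nsmul_eq_mul, mul_one]
        ring
      rw [absoluteGaloisGroup.smul_def, map_sub, map_one, ← absoluteGaloisGroup.smul_def, hσζ,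
        ← key, mul_geom_sum]

end Summit.ABC.ABC.Theorems

end
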